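import Literature.AnabelianGeometry.EtaleTheta.BiKummerThm44SubModelConnectedBinjRootsReading
import Literature.AnabelianGeometry.EtaleTheta.BiKummerThm44SubModelConnectedBinjWeak
import Literature.AnabelianGeometry.EtaleTheta.DivisorMonoidsOfGaloisCoveringConnected
import Literature.AnabelianGeometry.EtaleTheta.Discharge.Sec3BLambdaInjectiveOfRlf
import Literature.AnabelianGeometry.EtaleTheta.Discharge.Sec3Prop34iPhiZero

/-!
# [EtTh] Theorem 4.4 (i)(ii)(iii) + `N`-th roots at the genuine connected base OVER THE CONSTRUCTED Def 3.3 (iii)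
# DATA of the connected coverings dominated by one universal combinatorial covering — END KNIT: the last binder
# `hBinj` is a THEOREM there; at the roots reading NO input remains (proof-only)

S. Mochizuki, *The étale theta function and its Frobenioid-theoretic manifestations*, Publ. RIMS **45** (2009)
[MochizukiEtTh2009], §4, Thm 4.4 (i)–(iii), PDF p.94 (printed p.320), proof PDF p.95; §3, Def 3.3 (iii) PDF p.73
(`Φ₀(Y^log) := lim Div⁺(Z^log_∞)^{Gal(Z^log_∞/Y^log)}`, `B₀(Y^log) := lim Mero(Z^log_∞)^{Gal(Z^log_∞/Y^log)}`, `D₀ :=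
B^temp(X^log)⁰`), Prop 3.4 (i) PDF p.74, Def 3.6 (i)(ii) PDF pp.76–77.  abc-iut cell, layer L2,
plan/L2/SUBDAG-EtTh-Thm44.md (custodian lineage abc-iut-w5-d179), cone nodes `EtTh:Thm4.4(i)`, `EtTh:Thm4.4(ii)`,
`EtTh:Thm4.4(iii)`.  Seat abc-iut-w5-d179 (gen 5).  PROOF-ONLY (0 `def`s, no `Prop` facts, no instances); nothing
landed is edited or restated.

WHY.  The lineage's closers of record for Thm 4.4 (i)(ii)(iii)(+ roots) at abc-iut-L2-t4's genuine connected base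
`mkOfConnectedTemperoid` — `Thm44Hyp.thm44_mkOfConnectedTemperoid_of_hBinj` (p434227, strong vocabulary) and
abc-iut-w6-d037's weak-vocabulary twin `…_of_hBinj_treeVocabWeak` (p435574) — leave as their ONLY structural input the
binder

  `hBinj : ∀ {Y Y' : D₀ᵒᵖ} (g : Y ⟶ Y'), Injective (T.BΛ.map g).hom`

("the pull-backs of the Def 3.6 (i) datum `B₀^Λ` are injective"), plus T44-L15b ([FrdII] Def 2.2 (ii)) for the
faithful `(N,H)`-slot and NOTHING at its roots reading.  abc-iut-w6-d058 has now CONSTRUCTED the Def 3.3 (iii) data of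
the connected coverings dominated by a universal combinatorial covering `Z^log_∞` with Galois group `G`:
`DivisorMonoids.ofGaloisActionConnected A hZ` over `D₀ :=` the nonempty transitive `G`-sets (p437704), and PROVED
there that the transition maps of `B₀` are injective (`ofGaloisActionConnected_B₀_map_injective`: inclusions
`Mero(Z_∞)^H ↪ Mero(Z_∞)^{H'}`); abc-iut-w6-d057 PROVED Prop 3.4 (i) "`Φ₀(Y)` perf-factorial" in the weak vocabulary
of record for every piece (`isPerfFactorialCof_phiZero`, p436557); abc-iut-L2-t3 reduced `hBinj` at the Def 3.6 (i)
constructors `ofRlfZ` / `ofRlfZWeak` (`Λ = ℤ`) and `ofRlfQ` / `ofRlfQWeak` to the `B₀`-level clause (p435417).  This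
file KNITS these by name:

* §0 `DivisorMonoids.ofGaloisActionConnected_isPerfFactorialCof` — the `hpf` slot of `ofRlfZWeak` / `ofRlfQWeak` at
  the connected data, PROVED; `…_ofRlfZWeak_hBinj` / `…_ofRlfQWeak_hBinj` — **`hBinj` is a THEOREM** at the weak Def
  3.6 (i) data over the connected data (no input at all); `…_ofRlfZ_hBinj` / `…_ofRlfQ_hBinj` — the same at the
  strong constructors, whose printed perf-factorial slot `hpf` stays the constructor's own parameter (HONEST LABEL:
  the printed reading of "perf-factorial" fails for pieces with infinitely many Galois orbits of prime log-divisors,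
  plan/FACT-LIST F-L2d2-1; the weak data is the one of record);
* §1 (weak vocabulary, `Λ = ℤ`) **`Thm44Hyp.thm44_mkOfConnectedTemperoid_ofGaloisActionConnected_treeVocabWeak`:
  [EtTh] Thm 4.4 (i) ∧ (ii) ∧ (iii)-saturation ∧ (`N`-th roots) at the genuine connected base `B^temp(Π^tp_X)⁰`, for
  ANY tempered Frobenioids `tf₁`, `tf₂` over the weak Def 3.6 (i) data of two such connected-covering data
  ⇐ {T44-L15b} ONLY**, and **`…_rootsReading_ofGaloisActionConnected_treeVocabWeak`: at the ROOTS READING of the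
  `(N, H_⊙^{bs-fld})`-slot ⇐ NOTHING** — no binder, no named fact of plan/FACT-LIST, no sub-DAG row, no
  perf-factorial hypothesis (`Thm44_i` alone: `thm44_i_mkOfConnectedTemperoid_ofGaloisActionConnected_treeVocabWeak`,
  unconditional);
* §2 (strong vocabulary, `Λ = ℤ`) the twins at `ofRlfZ … hpf`, ⇐ {T44-L15b} / ⇐ NOTHING beyond the constructor
  parameter `hpf`.

Universe bookkeeping: `D₀ = (isConnectedGSet (G := G)).FullSubcategory : Type (u+1)` with `Category.{u}`, so the
lineage theorems are instantiated at `K, K' : Type (u+1)`, `X_i : TemperedArithmeticGroup.{u+1}`, monoid universe `u`;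
the base functors `tf_i.base : B^temp(Π^tp_{X_i})⁰ ⥤ D₀` are the tempered Frobenioids' own data (no junction functor is
posited here).

HONEST FRAMING: refereed pre-IUT material ([FrdI]/[FrdII] 2008, [EtTh] 2009, [SemiAnbd] 2006); every theorem is an
implication for data so parametrised (`LogDivisorModel` / `GaloisAction` / `CuspLaws` are interface and parameter
records — nothing asserts they arise from an actual curve); the roots reading is WEAKER than print's cohomological
[FrdII] Def 2.2 (ii)(c) (label carried in the names); the inductive LIMIT over the `Δ^fil`-closures of Def 3.3 (iii)
is not formed (one term of the limit, Rmk 3.3.1); nothing here bears on the disputed [IUTchIII] Cor. 3.12; typed ≠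
proved — here PROVED (kernel compositions).
-/

noncomputable section

namespace Literature.AnabelianGeometry.EtaleTheta

open CategoryTheory Opposite Function Literature.AlgebraicGeometry.Frobenioids Literature.AnabelianGeometry.SemiGraphs

universe u

/-! ### §0 The binders of the lineage at the constructed connected-covering data: all THEOREMS -/

namespace DivisorMonoids

open LogDivisorModel.GaloisAction

variable {Z : LogDivisorModel.{u}} {G : Type u} [Group G] (A : Z.GaloisAction G) (hZ : Z.CuspLaws)

/-- **Prop 3.4 (i) for every `Φ₀(Y)` of the connected-covering data, weak vocabulary with cofinal perfection** — the
`hpf` slot of the Def 3.6 (i) constructors `ofRlfZWeak` / `ofRlfQWeak` at `ofGaloisActionConnected A hZ`, PROVED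
(abc-iut-w6-d057's `isPerfFactorialCof_phiZero` at the `G`-set `Y`; `Φ₀.obj Y` is `Hom_G(Y, Div⁺(Z^log_∞))` by
construction). [cite: MochizukiEtTh2009, Prop 3.4 p.74] -/
theorem ofGaloisActionConnected_isPerfFactorialCof (Y : ((isConnectedGSet (G := G)).FullSubcategory)ᵒᵖ) :
    IsPerfFactorialCof ((ofGaloisActionConnected A hZ).Φ₀.obj Y) :=
  A.isPerfFactorialCof_phiZero Y.unop.obj

/-- **`hBinj` is a THEOREM at the weak Def 3.6 (i) data `Λ = ℤ` over the connected coverings**: every pull-back of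
`B₀^ℤ = B₀ = Hom_G(−, Mero(Z^log_∞))` along a map of connected coverings is injective (abc-iut-w6-d058's
`ofGaloisActionConnected_B₀_map_injective` through abc-iut-L2-t3's `ofRlfZWeak_hBinj`), for any proof `hpf` of the
perf-factorial slot (e.g. `ofGaloisActionConnected_isPerfFactorialCof`). [cite: MochizukiEtTh2009, Def 3.6 p.76] -/
theorem ofGaloisActionConnected_ofRlfZWeak_hBinj
    (hpf : ∀ Y : ((isConnectedGSet (G := G)).FullSubcategory)ᵒᵖ, IsPerfFactorialCof ((ofGaloisActionConnected A hZ).Φ₀.obj Y)) :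
    ∀ {Y Y' : ((isConnectedGSet (G := G)).FullSubcategory)ᵒᵖ} (g : Y ⟶ Y'),
      Injective ((RealifiedDivisorMonoids.ofRlfZWeak (ofGaloisActionConnected A hZ) hpf).BΛ.map g).hom :=
  RealifiedDivisorMonoids.ofRlfZWeak_hBinj (ofGaloisActionConnected A hZ) hpf
    fun g => ofGaloisActionConnected_B₀_map_injective A hZ g

/-- **`hBinj` is a THEOREM at the weak Def 3.6 (i) data `Λ = ℚ` over the connected coverings** (`B₀^ℚ = B₀^pf`;
abc-iut-L2-t3's `ofRlfQWeak_hBinj`). [cite: MochizukiEtTh2009, Def 3.6 p.76] -/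
theorem ofGaloisActionConnected_ofRlfQWeak_hBinj
    (hpf : ∀ Y : ((isConnectedGSet (G := G)).FullSubcategory)ᵒᵖ, IsPerfFactorialCof ((ofGaloisActionConnected A hZ).Φ₀.obj Y)) :
    ∀ {Y Y' : ((isConnectedGSet (G := G)).FullSubcategory)ᵒᵖ} (g : Y ⟶ Y'),
      Injective ((RealifiedDivisorMonoids.ofRlfQWeak (ofGaloisActionConnected A hZ) hpf).BΛ.map g).hom :=
  RealifiedDivisorMonoids.ofRlfQWeak_hBinj (ofGaloisActionConnected A hZ) hpf
    fun g => ofGaloisActionConnected_B₀_map_injective A hZ g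

/-- **`hBinj` is a THEOREM at the strong Def 3.6 (i) data `Λ = ℤ` over the connected coverings**, for any value of
the constructor's printed perf-factorial parameter `hpf` (abc-iut-L2-t3's `ofRlfZ_hBinj`). [cite: MochizukiEtTh2009, Def 3.6 p.76] -/
theorem ofGaloisActionConnected_ofRlfZ_hBinj
    (hpf : ∀ Y : ((isConnectedGSet (G := G)).FullSubcategory)ᵒᵖ, IsPerfFactorial ((ofGaloisActionConnected A hZ).Φ₀.obj Y)) :
    ∀ {Y Y' : ((isConnectedGSet (G := G)).FullSubcategory)ᵒᵖ} (g : Y ⟶ Y'),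
      Injective ((RealifiedDivisorMonoids.ofRlfZ (ofGaloisActionConnected A hZ) hpf).BΛ.map g).hom :=
  RealifiedDivisorMonoids.ofRlfZ_hBinj (ofGaloisActionConnected A hZ) hpf
    fun g => ofGaloisActionConnected_B₀_map_injective A hZ g

/-- **`hBinj` is a THEOREM at the strong Def 3.6 (i) data `Λ = ℚ` over the connected coverings**
(abc-iut-L2-t3's `ofRlfQ_hBinj`). [cite: MochizukiEtTh2009, Def 3.6 p.76] -/
theorem ofGaloisActionConnected_ofRlfQ_hBinj
    (hpf : ∀ Y : ((isConnectedGSet (G := G)).FullSubcategory)ᵒᵖ, IsPerfFactorial ((ofGaloisActionConnected A hZ).Φ₀.obj Y)) :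
    ∀ {Y Y' : ((isConnectedGSet (G := G)).FullSubcategory)ᵒᵖ} (g : Y ⟶ Y'),
      Injective ((RealifiedDivisorMonoids.ofRlfQ (ofGaloisActionConnected A hZ) hpf).BΛ.map g).hom :=
  RealifiedDivisorMonoids.ofRlfQ_hBinj (ofGaloisActionConnected A hZ) hpf
    fun g => ofGaloisActionConnected_B₀_map_injective A hZ g

end DivisorMonoids

/-! ### §1 [EtTh] Thm 4.4 at the genuine connected base over the WEAK Def 3.6 (i) data of the connected coverings -/

namespace BiKummerSetting

section Weak

variable {Z₁ : LogDivisorModel.{u}} {G₁ : Type u} [Group G₁] (GA₁ : Z₁.GaloisAction G₁) (hC₁ : Z₁.CuspLaws)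
  {Z₂ : LogDivisorModel.{u}} {G₂ : Type u} [Group G₂] (GA₂ : Z₂.GaloisAction G₂) (hC₂ : Z₂.CuspLaws)
  {K : Type (u + 1)} [Field K] {K' : Type (u + 1)} [Field K'] {X₁ : SemiGraphs.TemperedArithmeticGroup.{u + 1} K}
  {X₂ : SemiGraphs.TemperedArithmeticGroup.{u + 1} K'}
  {IsRational₁ IsStrictlyRational₁ : ((ConnectedPart (BTemp X₁.Pi))ᵒᵖ ⥤ CommMonCat.{u}) → Prop}
  {IsRational₂ IsStrictlyRational₂ : ((ConnectedPart (BTemp X₂.Pi))ᵒᵖ ⥤ CommMonCat.{u}) → Prop}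
  {tf₁ : TemperedFrobenioid
    (RealifiedDivisorMonoids.ofRlfZWeak (DivisorMonoids.ofGaloisActionConnected GA₁ hC₁)
      (DivisorMonoids.ofGaloisActionConnected_isPerfFactorialCof GA₁ hC₁))
    (ConnectedPart (BTemp X₁.Pi)) (treeCatVocab (ConnectedPart (BTemp X₁.Pi)) IsRational₁ IsStrictlyRational₁)}
  {hZ₁ : tf₁.monoidType = MonoidType.Z} {hP₁ : ∀ A : (ConnectedPart (BTemp X₁.Pi))ᵒᵖ, IsPerfect (tf₁.Φ.carrier A)}
  {NH₁ : Subgroup (Field.absoluteGaloisGroup K) → tf₁.category → ℕ+ → Prop} {A₁ : tf₁.category}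
  {hA₁ : PreFrobenioid.IsFrobeniusTrivial tf₁.toElem A₁} {hA₁' : SemiGraphs.IsGaloisObj A₁.base.obj}
  {tf₂ : TemperedFrobenioid
    (RealifiedDivisorMonoids.ofRlfZWeak (DivisorMonoids.ofGaloisActionConnected GA₂ hC₂)
      (DivisorMonoids.ofGaloisActionConnected_isPerfFactorialCof GA₂ hC₂))
    (ConnectedPart (BTemp X₂.Pi)) (treeCatVocab (ConnectedPart (BTemp X₂.Pi)) IsRational₂ IsStrictlyRational₂)}
  {hZ₂ : tf₂.monoidType = MonoidType.Z} {hP₂ : ∀ B : (ConnectedPart (BTemp X₂.Pi))ᵒᵖ, IsPerfect (tf₂.Φ.carrier B)}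
  {NH₂ : Subgroup (Field.absoluteGaloisGroup K') → tf₂.category → ℕ+ → Prop} {A₂ : tf₂.category}
  {hA₂ : PreFrobenioid.IsFrobeniusTrivial tf₂.toElem A₂} {hA₂' : SemiGraphs.IsGaloisObj A₂.base.obj}

/-- **«`C_i` is a Frobenioid» (Def 3.6 (ii) / [FrdI] Thm 5.2 (ii)) for ANY tempered Frobenioid over the weak Def 3.6 (i)
data of the connected coverings — unconditional** (abc-iut-L2-t3's `isFrobenioid_of_structural` with BOTH inputs
discharged: `hBinj` by §0, FSM by [FrdII] Ex 1.3 (i) `connectedPart_isOfFSMType`). [cite: MochizukiEtTh2009, Def 3.6 p.77] -/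
theorem isFrobenioid_ofGaloisActionConnected_treeVocabWeak : PreFrobenioid.IsFrobenioid tf₁.toElem :=
  tf₁.isFrobenioid_of_structural (DivisorMonoids.ofGaloisActionConnected_ofRlfZWeak_hBinj GA₁ hC₁ _) fun α hα =>
    (QuasiTemperoid.BTempConnected.connectedPart_isOfFSMType (G := X₁.Pi)).isIso_of_isFSM α hα

/-- **T44-L03 «`Ψ` preserves the Frobenius structure» at the genuine connected base over the weak data of the connected
coverings — unconditional.** [cite: MochizukiEtTh2009, Thm 4.4 p.95] -/
theorem Thm44Hyp.preservesFrobeniusStructure_mkOfConnectedTemperoid_ofGaloisActionConnected_treeVocabWeak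
    (h : Thm44Hyp (mkOfConnectedTemperoid X₁ tf₁ hZ₁ hP₁ NH₁ A₁ hA₁ hA₁')
      (mkOfConnectedTemperoid X₂ tf₂ hZ₂ hP₂ NH₂ A₂ hA₂ hA₂')) :
    Thm44Hyp.PreservesFrobeniusStructure (V := treeMonoidVocabWeak.{u}) h :=
  h.preservesFrobeniusStructure_mkOfConnectedTemperoid_of_hBinj_treeVocabWeak
    (DivisorMonoids.ofGaloisActionConnected_ofRlfZWeak_hBinj GA₁ hC₁ _)
    (DivisorMonoids.ofGaloisActionConnected_ofRlfZWeak_hBinj GA₂ hC₂ _)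

/-- **[EtTh] Thm 4.4 (i) at the genuine connected base over the weak Def 3.6 (i) data of the connected coverings —
UNCONDITIONAL** (the base-category clause: abc-iut-w5-d013's Galois-compatibility through the lineage's
`thm44_i_mkOfConnectedTemperoid_of_hBinj_treeVocabWeak`, `hBinj` by §0). [cite: MochizukiEtTh2009, Thm 4.4 p.94] -/
theorem Thm44Hyp.thm44_i_mkOfConnectedTemperoid_ofGaloisActionConnected_treeVocabWeak
    (h : Thm44Hyp (mkOfConnectedTemperoid X₁ tf₁ hZ₁ hP₁ NH₁ A₁ hA₁ hA₁')
      (mkOfConnectedTemperoid X₂ tf₂ hZ₂ hP₂ NH₂ A₂ hA₂ hA₂')) :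
    Thm44_i (V := treeMonoidVocabWeak.{u}) h :=
  h.thm44_i_mkOfConnectedTemperoid_of_hBinj_treeVocabWeak
    (DivisorMonoids.ofGaloisActionConnected_ofRlfZWeak_hBinj GA₁ hC₁ _)
    (DivisorMonoids.ofGaloisActionConnected_ofRlfZWeak_hBinj GA₂ hC₂ _)

/-- **[EtTh] Theorem 4.4 (i) ∧ (ii) (fraction-pairs) ∧ (iii) (saturation) ∧ (ii) (`N`-th roots) at the genuine
connected base `B^temp(Π^tp_X)⁰` over the WEAK Def 3.6 (i) data `Λ = ℤ` of the connected coverings dominated by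
universal combinatorial coverings `Z₁^log_∞`, `Z₂^log_∞` ⇐ {T44-L15b} ONLY**, for `ψ = Ψ^birat = psiModel hF₁ hF₂ h3`
over ANY proofs (proof-irrelevant; e.g. `isFrobenioid_ofGaloisActionConnected_treeVocabWeak` and
`preservesFrobeniusStructure_…_ofGaloisActionConnected_treeVocabWeak`): the lineage's
`thm44_mkOfConnectedTemperoid_of_hBinj_treeVocabWeak` (p435574) with BOTH `hBinj` binders DISCHARGED by §0.  Binder
census at this data: {`hBinj₁`, `hBinj₂`, T44-L15b} ↦ {T44-L15b}. [cite: MochizukiEtTh2009, Thm 4.4 p.94] -/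
theorem Thm44Hyp.thm44_mkOfConnectedTemperoid_ofGaloisActionConnected_treeVocabWeak
    (h : Thm44Hyp (mkOfConnectedTemperoid X₁ tf₁ hZ₁ hP₁ NH₁ A₁ hA₁ hA₁')
      (mkOfConnectedTemperoid X₂ tf₂ hZ₂ hP₂ NH₂ A₂ hA₂ hA₂'))
    (hF₁ : PreFrobenioid.IsFrobenioid tf₁.toElem) (hF₂ : PreFrobenioid.IsFrobenioid tf₂.toElem)
    (h3 : h.PreservesFrobeniusStructure) (h15 : h.PreservesNHSaturatedBsFld) :
    Thm44_i (V := treeMonoidVocabWeak.{u}) h ∧ Thm44_ii h (h.psiModel hF₁ hF₂ h3) ∧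
      Thm44_iii h (h.psiModel hF₁ hF₂ h3) ∧
      h.PreservesNthRoots (h.psiModel hF₁ hF₂ h3) (fun φ f => tf₁.pullFracModel φ f)
        (fun φ f => tf₂.pullFracModel φ f) :=
  h.thm44_mkOfConnectedTemperoid_of_hBinj_treeVocabWeak hF₁ hF₂ h3
    (DivisorMonoids.ofGaloisActionConnected_ofRlfZWeak_hBinj GA₁ hC₁ _)
    (DivisorMonoids.ofGaloisActionConnected_ofRlfZWeak_hBinj GA₂ hC₂ _) h15

/-- **The same with every ψ-slot proof supplied by the tree** — literally ⇐ {T44-L15b}. [cite: MochizukiEtTh2009, Thm 4.4 p.94] -/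
theorem Thm44Hyp.thm44_mkOfConnectedTemperoid_ofGaloisActionConnected_treeVocabWeak'
    (h : Thm44Hyp (mkOfConnectedTemperoid X₁ tf₁ hZ₁ hP₁ NH₁ A₁ hA₁ hA₁')
      (mkOfConnectedTemperoid X₂ tf₂ hZ₂ hP₂ NH₂ A₂ hA₂ hA₂')) (h15 : h.PreservesNHSaturatedBsFld) :
    Thm44_i (V := treeMonoidVocabWeak.{u}) h ∧
      Thm44_ii h (h.psiModel (isFrobenioid_ofGaloisActionConnected_treeVocabWeak GA₁ hC₁)
        (isFrobenioid_ofGaloisActionConnected_treeVocabWeak GA₂ hC₂)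
        (h.preservesFrobeniusStructure_mkOfConnectedTemperoid_ofGaloisActionConnected_treeVocabWeak GA₁ hC₁ GA₂ hC₂)) ∧
      Thm44_iii h (h.psiModel (isFrobenioid_ofGaloisActionConnected_treeVocabWeak GA₁ hC₁)
        (isFrobenioid_ofGaloisActionConnected_treeVocabWeak GA₂ hC₂)
        (h.preservesFrobeniusStructure_mkOfConnectedTemperoid_ofGaloisActionConnected_treeVocabWeak GA₁ hC₁ GA₂ hC₂)) ∧
      h.PreservesNthRoots (h.psiModel (isFrobenioid_ofGaloisActionConnected_treeVocabWeak GA₁ hC₁)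
        (isFrobenioid_ofGaloisActionConnected_treeVocabWeak GA₂ hC₂)
        (h.preservesFrobeniusStructure_mkOfConnectedTemperoid_ofGaloisActionConnected_treeVocabWeak GA₁ hC₁ GA₂ hC₂))
        (fun φ f => tf₁.pullFracModel φ f) (fun φ f => tf₂.pullFracModel φ f) :=
  h.thm44_mkOfConnectedTemperoid_ofGaloisActionConnected_treeVocabWeak GA₁ hC₁ GA₂ hC₂ _ _ _ h15

end Weak

section WeakRoots

variable {Z₁ : LogDivisorModel.{u}} {G₁ : Type u} [Group G₁] (GA₁ : Z₁.GaloisAction G₁) (hC₁ : Z₁.CuspLaws)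
  {Z₂ : LogDivisorModel.{u}} {G₂ : Type u} [Group G₂] (GA₂ : Z₂.GaloisAction G₂) (hC₂ : Z₂.CuspLaws)
  {K : Type (u + 1)} [Field K] {K' : Type (u + 1)} [Field K'] {X₁ : SemiGraphs.TemperedArithmeticGroup.{u + 1} K}
  {X₂ : SemiGraphs.TemperedArithmeticGroup.{u + 1} K'}
  {IsRational₁ IsStrictlyRational₁ : ((ConnectedPart (BTemp X₁.Pi))ᵒᵖ ⥤ CommMonCat.{u}) → Prop}
  {IsRational₂ IsStrictlyRational₂ : ((ConnectedPart (BTemp X₂.Pi))ᵒᵖ ⥤ CommMonCat.{u}) → Prop}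
  {tf₁ : TemperedFrobenioid
    (RealifiedDivisorMonoids.ofRlfZWeak (DivisorMonoids.ofGaloisActionConnected GA₁ hC₁)
      (DivisorMonoids.ofGaloisActionConnected_isPerfFactorialCof GA₁ hC₁))
    (ConnectedPart (BTemp X₁.Pi)) (treeCatVocab (ConnectedPart (BTemp X₁.Pi)) IsRational₁ IsStrictlyRational₁)}
  {hZ₁ : tf₁.monoidType = MonoidType.Z} {hP₁ : ∀ A : (ConnectedPart (BTemp X₁.Pi))ᵒᵖ, IsPerfect (tf₁.Φ.carrier A)}
  {A₁ : tf₁.category} {hA₁ : PreFrobenioid.IsFrobeniusTrivial tf₁.toElem A₁}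
  {hA₁' : SemiGraphs.IsGaloisObj A₁.base.obj}
  {tf₂ : TemperedFrobenioid
    (RealifiedDivisorMonoids.ofRlfZWeak (DivisorMonoids.ofGaloisActionConnected GA₂ hC₂)
      (DivisorMonoids.ofGaloisActionConnected_isPerfFactorialCof GA₂ hC₂))
    (ConnectedPart (BTemp X₂.Pi)) (treeCatVocab (ConnectedPart (BTemp X₂.Pi)) IsRational₂ IsStrictlyRational₂)}
  {hZ₂ : tf₂.monoidType = MonoidType.Z} {hP₂ : ∀ B : (ConnectedPart (BTemp X₂.Pi))ᵒᵖ, IsPerfect (tf₂.Φ.carrier B)}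
  {A₂ : tf₂.category} {hA₂ : PreFrobenioid.IsFrobeniusTrivial tf₂.toElem A₂}
  {hA₂' : SemiGraphs.IsGaloisObj A₂.base.obj}

/-- **[EtTh] Theorem 4.4 (i) ∧ (ii) ∧ (iii) ∧ (`N`-th roots) at the genuine connected base `B^temp(Π^tp_X)⁰` over the
WEAK Def 3.6 (i) data of the connected coverings, AT THE ROOTS READING of the `(N, H_⊙^{bs-fld})`-saturation slot
⇐ NOTHING** (`ψ = psiModel hF₁ hF₂ h3` over any proofs — themselves supplied unconditionally by this file): the
lineage's `thm44_mkOfConnectedTemperoid_of_hBinj_treeVocabWeak` with `hBinj` by §0 and T44-L15b by abc-iut-w4-d044's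
`preservesNHSaturatedBsFld_rootsReading` (p431503; HONEST LABEL: the roots reading is WEAKER than print's
cohomological [FrdII] Def 2.2 (ii)(c) — at the faithful reading T44-L15b stays the one input, see §1).  No binder, no
plan/FACT-LIST fact, no sub-DAG row, no perf-factorial hypothesis is an input of the three cone nodes at this data.
[cite: MochizukiEtTh2009, Thm 4.4 p.94] -/
theorem Thm44Hyp.thm44_mkOfConnectedTemperoid_rootsReading_ofGaloisActionConnected_treeVocabWeak
    (h : Thm44Hyp
      (mkOfConnectedTemperoid X₁ tf₁ hZ₁ hP₁
        (fun _ A M => ∀ (g : A.base ⟶ A₁.base) (x : tf₁.ratFnFunctor.obj (op A₁.base)),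
          divB tf₁.divisorMonoid tf₁.ratFnFunctor tf₁.divBNatTrans (op A₁.base) x = 1 →
            ∃ ζ : tf₁.ratFnFunctor.obj (op A.base), ζ ^ (M : ℕ) = pull tf₁.ratFnFunctor g x)
        A₁ hA₁ hA₁')
      (mkOfConnectedTemperoid X₂ tf₂ hZ₂ hP₂
        (fun _ A M => ∀ (g : A.base ⟶ A₂.base) (x : tf₂.ratFnFunctor.obj (op A₂.base)),
          divB tf₂.divisorMonoid tf₂.ratFnFunctor tf₂.divBNatTrans (op A₂.base) x = 1 →
            ∃ ζ : tf₂.ratFnFunctor.obj (op A.base), ζ ^ (M : ℕ) = pull tf₂.ratFnFunctor g x)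
        A₂ hA₂ hA₂'))
    (hF₁ : PreFrobenioid.IsFrobenioid tf₁.toElem) (hF₂ : PreFrobenioid.IsFrobenioid tf₂.toElem)
    (h3 : h.PreservesFrobeniusStructure) :
    Thm44_i (V := treeMonoidVocabWeak.{u}) h ∧ Thm44_ii h (h.psiModel hF₁ hF₂ h3) ∧
      Thm44_iii h (h.psiModel hF₁ hF₂ h3) ∧
      h.PreservesNthRoots (h.psiModel hF₁ hF₂ h3) (fun φ f => tf₁.pullFracModel φ f)
        (fun φ f => tf₂.pullFracModel φ f) :=
  h.thm44_mkOfConnectedTemperoid_of_hBinj_treeVocabWeak hF₁ hF₂ h3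
    (DivisorMonoids.ofGaloisActionConnected_ofRlfZWeak_hBinj GA₁ hC₁ _)
    (DivisorMonoids.ofGaloisActionConnected_ofRlfZWeak_hBinj GA₂ hC₂ _)
    (Thm44Hyp.preservesNHSaturatedBsFld_rootsReading tf₁ hZ₁ hP₁ _ _ _ A₁ hA₁ hA₁' tf₂ hZ₂ hP₂ _ _ _ A₂ hA₂ hA₂' h
      hF₁ hF₂ h3)

/-- **The same with every ψ-slot proof supplied by the tree — [EtTh] Thm 4.4 (i) ∧ (ii) ∧ (iii) ∧ roots at the roots
reading over the weak data of the connected coverings, LITERALLY UNCONDITIONAL.** [cite: MochizukiEtTh2009, Thm 4.4 p.94] -/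
theorem Thm44Hyp.thm44_mkOfConnectedTemperoid_rootsReading_ofGaloisActionConnected_treeVocabWeak'
    (h : Thm44Hyp
      (mkOfConnectedTemperoid X₁ tf₁ hZ₁ hP₁
        (fun _ A M => ∀ (g : A.base ⟶ A₁.base) (x : tf₁.ratFnFunctor.obj (op A₁.base)),
          divB tf₁.divisorMonoid tf₁.ratFnFunctor tf₁.divBNatTrans (op A₁.base) x = 1 →
            ∃ ζ : tf₁.ratFnFunctor.obj (op A.base), ζ ^ (M : ℕ) = pull tf₁.ratFnFunctor g x)
        A₁ hA₁ hA₁')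
      (mkOfConnectedTemperoid X₂ tf₂ hZ₂ hP₂
        (fun _ A M => ∀ (g : A.base ⟶ A₂.base) (x : tf₂.ratFnFunctor.obj (op A₂.base)),
          divB tf₂.divisorMonoid tf₂.ratFnFunctor tf₂.divBNatTrans (op A₂.base) x = 1 →
            ∃ ζ : tf₂.ratFnFunctor.obj (op A.base), ζ ^ (M : ℕ) = pull tf₂.ratFnFunctor g x)
        A₂ hA₂ hA₂')) :
    Thm44_i (V := treeMonoidVocabWeak.{u}) h ∧
      Thm44_ii h (h.psiModel (isFrobenioid_ofGaloisActionConnected_treeVocabWeak GA₁ hC₁)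
        (isFrobenioid_ofGaloisActionConnected_treeVocabWeak GA₂ hC₂)
        (h.preservesFrobeniusStructure_mkOfConnectedTemperoid_ofGaloisActionConnected_treeVocabWeak GA₁ hC₁ GA₂ hC₂)) ∧
      Thm44_iii h (h.psiModel (isFrobenioid_ofGaloisActionConnected_treeVocabWeak GA₁ hC₁)
        (isFrobenioid_ofGaloisActionConnected_treeVocabWeak GA₂ hC₂)
        (h.preservesFrobeniusStructure_mkOfConnectedTemperoid_ofGaloisActionConnected_treeVocabWeak GA₁ hC₁ GA₂ hC₂)) ∧
      h.PreservesNthRoots (h.psiModel (isFrobenioid_ofGaloisActionConnected_treeVocabWeak GA₁ hC₁)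
        (isFrobenioid_ofGaloisActionConnected_treeVocabWeak GA₂ hC₂)
        (h.preservesFrobeniusStructure_mkOfConnectedTemperoid_ofGaloisActionConnected_treeVocabWeak GA₁ hC₁ GA₂ hC₂))
        (fun φ f => tf₁.pullFracModel φ f) (fun φ f => tf₂.pullFracModel φ f) :=
  h.thm44_mkOfConnectedTemperoid_rootsReading_ofGaloisActionConnected_treeVocabWeak GA₁ hC₁ GA₂ hC₂ _ _ _

end WeakRoots

/-! ### §2 The strong-vocabulary twins at `ofRlfZ … hpf` (printed perf-factorial slot kept as the constructor parameter) -/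

section Strong

variable {Z₁ : LogDivisorModel.{u}} {G₁ : Type u} [Group G₁] (GA₁ : Z₁.GaloisAction G₁) (hC₁ : Z₁.CuspLaws)
  (hpf₁ : ∀ Y : ((LogDivisorModel.GaloisAction.isConnectedGSet (G := G₁)).FullSubcategory)ᵒᵖ,
    IsPerfFactorial ((DivisorMonoids.ofGaloisActionConnected GA₁ hC₁).Φ₀.obj Y))
  {Z₂ : LogDivisorModel.{u}} {G₂ : Type u} [Group G₂] (GA₂ : Z₂.GaloisAction G₂) (hC₂ : Z₂.CuspLaws)
  (hpf₂ : ∀ Y : ((LogDivisorModel.GaloisAction.isConnectedGSet (G := G₂)).FullSubcategory)ᵒᵖ,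
    IsPerfFactorial ((DivisorMonoids.ofGaloisActionConnected GA₂ hC₂).Φ₀.obj Y))
  {K : Type (u + 1)} [Field K] {K' : Type (u + 1)} [Field K'] {X₁ : SemiGraphs.TemperedArithmeticGroup.{u + 1} K}
  {X₂ : SemiGraphs.TemperedArithmeticGroup.{u + 1} K'}
  {IsRational₁ IsStrictlyRational₁ : ((ConnectedPart (BTemp X₁.Pi))ᵒᵖ ⥤ CommMonCat.{u}) → Prop}
  {IsRational₂ IsStrictlyRational₂ : ((ConnectedPart (BTemp X₂.Pi))ᵒᵖ ⥤ CommMonCat.{u}) → Prop}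
  {tf₁ : TemperedFrobenioid (RealifiedDivisorMonoids.ofRlfZ (DivisorMonoids.ofGaloisActionConnected GA₁ hC₁) hpf₁)
    (ConnectedPart (BTemp X₁.Pi)) (treeCatVocab (ConnectedPart (BTemp X₁.Pi)) IsRational₁ IsStrictlyRational₁)}
  {hZ₁ : tf₁.monoidType = MonoidType.Z} {hP₁ : ∀ A : (ConnectedPart (BTemp X₁.Pi))ᵒᵖ, IsPerfect (tf₁.Φ.carrier A)}
  {NH₁ : Subgroup (Field.absoluteGaloisGroup K) → tf₁.category → ℕ+ → Prop} {A₁ : tf₁.category}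
  {hA₁ : PreFrobenioid.IsFrobeniusTrivial tf₁.toElem A₁} {hA₁' : SemiGraphs.IsGaloisObj A₁.base.obj}
  {tf₂ : TemperedFrobenioid (RealifiedDivisorMonoids.ofRlfZ (DivisorMonoids.ofGaloisActionConnected GA₂ hC₂) hpf₂)
    (ConnectedPart (BTemp X₂.Pi)) (treeCatVocab (ConnectedPart (BTemp X₂.Pi)) IsRational₂ IsStrictlyRational₂)}
  {hZ₂ : tf₂.monoidType = MonoidType.Z} {hP₂ : ∀ B : (ConnectedPart (BTemp X₂.Pi))ᵒᵖ, IsPerfect (tf₂.Φ.carrier B)}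
  {NH₂ : Subgroup (Field.absoluteGaloisGroup K') → tf₂.category → ℕ+ → Prop} {A₂ : tf₂.category}
  {hA₂ : PreFrobenioid.IsFrobeniusTrivial tf₂.toElem A₂} {hA₂' : SemiGraphs.IsGaloisObj A₂.base.obj}

/-- **«`C_i` is a Frobenioid» for ANY tempered Frobenioid over the strong Def 3.6 (i) data of the connected coverings**
(abc-iut-L2-t3's `isFrobenioid_of_structural`, both inputs discharged). [cite: MochizukiEtTh2009, Def 3.6 p.77] -/
theorem isFrobenioid_ofGaloisActionConnected : PreFrobenioid.IsFrobenioid tf₁.toElem :=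
  tf₁.isFrobenioid_of_structural (DivisorMonoids.ofGaloisActionConnected_ofRlfZ_hBinj GA₁ hC₁ hpf₁) fun α hα =>
    (QuasiTemperoid.BTempConnected.connectedPart_isOfFSMType (G := X₁.Pi)).isIso_of_isFSM α hα

/-- **T44-L03 at the genuine connected base over the strong data of the connected coverings.** [cite: MochizukiEtTh2009, Thm 4.4 p.95] -/
theorem Thm44Hyp.preservesFrobeniusStructure_mkOfConnectedTemperoid_ofGaloisActionConnected
    (h : Thm44Hyp (mkOfConnectedTemperoid X₁ tf₁ hZ₁ hP₁ NH₁ A₁ hA₁ hA₁')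
      (mkOfConnectedTemperoid X₂ tf₂ hZ₂ hP₂ NH₂ A₂ hA₂ hA₂')) :
    h.PreservesFrobeniusStructure :=
  h.preservesFrobeniusStructure_mkOfConnectedTemperoid_of_hBinj
    (DivisorMonoids.ofGaloisActionConnected_ofRlfZ_hBinj GA₁ hC₁ hpf₁)
    (DivisorMonoids.ofGaloisActionConnected_ofRlfZ_hBinj GA₂ hC₂ hpf₂)

/-- **[EtTh] Thm 4.4 (i) at the genuine connected base over the strong Def 3.6 (i) data of the connected coverings** —
no input beyond the constructor parameters `hpf₁` / `hpf₂`. [cite: MochizukiEtTh2009, Thm 4.4 p.94] -/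
theorem Thm44Hyp.thm44_i_mkOfConnectedTemperoid_ofGaloisActionConnected
    (h : Thm44Hyp (mkOfConnectedTemperoid X₁ tf₁ hZ₁ hP₁ NH₁ A₁ hA₁ hA₁')
      (mkOfConnectedTemperoid X₂ tf₂ hZ₂ hP₂ NH₂ A₂ hA₂ hA₂')) : Thm44_i h :=
  h.thm44_i_mkOfConnectedTemperoid_of_hBinj (DivisorMonoids.ofGaloisActionConnected_ofRlfZ_hBinj GA₁ hC₁ hpf₁)
    (DivisorMonoids.ofGaloisActionConnected_ofRlfZ_hBinj GA₂ hC₂ hpf₂)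

/-- **[EtTh] Theorem 4.4 (i) ∧ (ii) ∧ (iii) ∧ (`N`-th roots) at the genuine connected base over the STRONG Def 3.6 (i)
data `Λ = ℤ` of the connected coverings ⇐ {T44-L15b} ONLY** (beyond the constructor parameters `hpf₁` / `hpf₂`):
p434227's `thm44_mkOfConnectedTemperoid_of_hBinj` with both `hBinj` binders DISCHARGED by §0.
[cite: MochizukiEtTh2009, Thm 4.4 p.94] -/
theorem Thm44Hyp.thm44_mkOfConnectedTemperoid_ofGaloisActionConnected
    (h : Thm44Hyp (mkOfConnectedTemperoid X₁ tf₁ hZ₁ hP₁ NH₁ A₁ hA₁ hA₁')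
      (mkOfConnectedTemperoid X₂ tf₂ hZ₂ hP₂ NH₂ A₂ hA₂ hA₂'))
    (hF₁ : PreFrobenioid.IsFrobenioid tf₁.toElem) (hF₂ : PreFrobenioid.IsFrobenioid tf₂.toElem)
    (h3 : h.PreservesFrobeniusStructure) (h15 : h.PreservesNHSaturatedBsFld) :
    Thm44_i h ∧ Thm44_ii h (h.psiModel hF₁ hF₂ h3) ∧ Thm44_iii h (h.psiModel hF₁ hF₂ h3) ∧
      h.PreservesNthRoots (h.psiModel hF₁ hF₂ h3) (fun φ f => tf₁.pullFracModel φ f)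
        (fun φ f => tf₂.pullFracModel φ f) :=
  h.thm44_mkOfConnectedTemperoid_of_hBinj hF₁ hF₂ h3 (DivisorMonoids.ofGaloisActionConnected_ofRlfZ_hBinj GA₁ hC₁ hpf₁)
    (DivisorMonoids.ofGaloisActionConnected_ofRlfZ_hBinj GA₂ hC₂ hpf₂) h15

/-- **The same with every ψ-slot proof supplied by the tree** — literally ⇐ {T44-L15b}. [cite: MochizukiEtTh2009, Thm 4.4 p.94] -/
theorem Thm44Hyp.thm44_mkOfConnectedTemperoid_ofGaloisActionConnected'
    (h : Thm44Hyp (mkOfConnectedTemperoid X₁ tf₁ hZ₁ hP₁ NH₁ A₁ hA₁ hA₁')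
      (mkOfConnectedTemperoid X₂ tf₂ hZ₂ hP₂ NH₂ A₂ hA₂ hA₂')) (h15 : h.PreservesNHSaturatedBsFld) :
    Thm44_i h ∧
      Thm44_ii h (h.psiModel (isFrobenioid_ofGaloisActionConnected GA₁ hC₁ hpf₁)
        (isFrobenioid_ofGaloisActionConnected GA₂ hC₂ hpf₂)
        (h.preservesFrobeniusStructure_mkOfConnectedTemperoid_ofGaloisActionConnected GA₁ hC₁ hpf₁ GA₂ hC₂ hpf₂)) ∧
      Thm44_iii h (h.psiModel (isFrobenioid_ofGaloisActionConnected GA₁ hC₁ hpf₁)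
        (isFrobenioid_ofGaloisActionConnected GA₂ hC₂ hpf₂)
        (h.preservesFrobeniusStructure_mkOfConnectedTemperoid_ofGaloisActionConnected GA₁ hC₁ hpf₁ GA₂ hC₂ hpf₂)) ∧
      h.PreservesNthRoots (h.psiModel (isFrobenioid_ofGaloisActionConnected GA₁ hC₁ hpf₁)
        (isFrobenioid_ofGaloisActionConnected GA₂ hC₂ hpf₂)
        (h.preservesFrobeniusStructure_mkOfConnectedTemperoid_ofGaloisActionConnected GA₁ hC₁ hpf₁ GA₂ hC₂ hpf₂))
        (fun φ f => tf₁.pullFracModel φ f) (fun φ f => tf₂.pullFracModel φ f) :=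
  h.thm44_mkOfConnectedTemperoid_ofGaloisActionConnected GA₁ hC₁ hpf₁ GA₂ hC₂ hpf₂ _ _ _ h15

end Strong

section StrongRoots

variable {Z₁ : LogDivisorModel.{u}} {G₁ : Type u} [Group G₁] (GA₁ : Z₁.GaloisAction G₁) (hC₁ : Z₁.CuspLaws)
  (hpf₁ : ∀ Y : ((LogDivisorModel.GaloisAction.isConnectedGSet (G := G₁)).FullSubcategory)ᵒᵖ,
    IsPerfFactorial ((DivisorMonoids.ofGaloisActionConnected GA₁ hC₁).Φ₀.obj Y))
  {Z₂ : LogDivisorModel.{u}} {G₂ : Type u} [Group G₂] (GA₂ : Z₂.GaloisAction G₂) (hC₂ : Z₂.CuspLaws)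
  (hpf₂ : ∀ Y : ((LogDivisorModel.GaloisAction.isConnectedGSet (G := G₂)).FullSubcategory)ᵒᵖ,
    IsPerfFactorial ((DivisorMonoids.ofGaloisActionConnected GA₂ hC₂).Φ₀.obj Y))
  {K : Type (u + 1)} [Field K] {K' : Type (u + 1)} [Field K'] {X₁ : SemiGraphs.TemperedArithmeticGroup.{u + 1} K}
  {X₂ : SemiGraphs.TemperedArithmeticGroup.{u + 1} K'}
  {IsRational₁ IsStrictlyRational₁ : ((ConnectedPart (BTemp X₁.Pi))ᵒᵖ ⥤ CommMonCat.{u}) → Prop}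
  {IsRational₂ IsStrictlyRational₂ : ((ConnectedPart (BTemp X₂.Pi))ᵒᵖ ⥤ CommMonCat.{u}) → Prop}
  {tf₁ : TemperedFrobenioid (RealifiedDivisorMonoids.ofRlfZ (DivisorMonoids.ofGaloisActionConnected GA₁ hC₁) hpf₁)
    (ConnectedPart (BTemp X₁.Pi)) (treeCatVocab (ConnectedPart (BTemp X₁.Pi)) IsRational₁ IsStrictlyRational₁)}
  {hZ₁ : tf₁.monoidType = MonoidType.Z} {hP₁ : ∀ A : (ConnectedPart (BTemp X₁.Pi))ᵒᵖ, IsPerfect (tf₁.Φ.carrier A)}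
  {A₁ : tf₁.category} {hA₁ : PreFrobenioid.IsFrobeniusTrivial tf₁.toElem A₁}
  {hA₁' : SemiGraphs.IsGaloisObj A₁.base.obj}
  {tf₂ : TemperedFrobenioid (RealifiedDivisorMonoids.ofRlfZ (DivisorMonoids.ofGaloisActionConnected GA₂ hC₂) hpf₂)
    (ConnectedPart (BTemp X₂.Pi)) (treeCatVocab (ConnectedPart (BTemp X₂.Pi)) IsRational₂ IsStrictlyRational₂)}
  {hZ₂ : tf₂.monoidType = MonoidType.Z} {hP₂ : ∀ B : (ConnectedPart (BTemp X₂.Pi))ᵒᵖ, IsPerfect (tf₂.Φ.carrier B)}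
  {A₂ : tf₂.category} {hA₂ : PreFrobenioid.IsFrobeniusTrivial tf₂.toElem A₂}
  {hA₂' : SemiGraphs.IsGaloisObj A₂.base.obj}

/-- **[EtTh] Theorem 4.4 (i) ∧ (ii) ∧ (iii) ∧ (`N`-th roots) at the genuine connected base over the STRONG Def 3.6 (i)
data of the connected coverings AT THE ROOTS READING ⇐ NOTHING** beyond the constructor parameters `hpf₁` / `hpf₂`
(p435745's `thm44_mkOfConnectedTemperoid_rootsReading_of_hBinj` with `hBinj` by §0; HONEST LABEL as in §1).
[cite: MochizukiEtTh2009, Thm 4.4 p.94] -/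
theorem Thm44Hyp.thm44_mkOfConnectedTemperoid_rootsReading_ofGaloisActionConnected
    (h : Thm44Hyp
      (mkOfConnectedTemperoid X₁ tf₁ hZ₁ hP₁
        (fun _ A M => ∀ (g : A.base ⟶ A₁.base) (x : tf₁.ratFnFunctor.obj (op A₁.base)),
          divB tf₁.divisorMonoid tf₁.ratFnFunctor tf₁.divBNatTrans (op A₁.base) x = 1 →
            ∃ ζ : tf₁.ratFnFunctor.obj (op A.base), ζ ^ (M : ℕ) = pull tf₁.ratFnFunctor g x)
        A₁ hA₁ hA₁')
      (mkOfConnectedTemperoid X₂ tf₂ hZ₂ hP₂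
        (fun _ A M => ∀ (g : A.base ⟶ A₂.base) (x : tf₂.ratFnFunctor.obj (op A₂.base)),
          divB tf₂.divisorMonoid tf₂.ratFnFunctor tf₂.divBNatTrans (op A₂.base) x = 1 →
            ∃ ζ : tf₂.ratFnFunctor.obj (op A.base), ζ ^ (M : ℕ) = pull tf₂.ratFnFunctor g x)
        A₂ hA₂ hA₂'))
    (hF₁ : PreFrobenioid.IsFrobenioid tf₁.toElem) (hF₂ : PreFrobenioid.IsFrobenioid tf₂.toElem)
    (h3 : h.PreservesFrobeniusStructure) :
    Thm44_i h ∧ Thm44_ii h (h.psiModel hF₁ hF₂ h3) ∧ Thm44_iii h (h.psiModel hF₁ hF₂ h3) ∧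
      h.PreservesNthRoots (h.psiModel hF₁ hF₂ h3) (fun φ f => tf₁.pullFracModel φ f)
        (fun φ f => tf₂.pullFracModel φ f) :=
  Thm44Hyp.thm44_mkOfConnectedTemperoid_rootsReading_of_hBinj tf₁ hZ₁ hP₁ A₁ hA₁ hA₁' tf₂ hZ₂ hP₂ A₂ hA₂ hA₂' h hF₁ hF₂
    h3 (DivisorMonoids.ofGaloisActionConnected_ofRlfZ_hBinj GA₁ hC₁ hpf₁)
    (DivisorMonoids.ofGaloisActionConnected_ofRlfZ_hBinj GA₂ hC₂ hpf₂)

/-- **The same with every ψ-slot proof supplied by the tree** — at the roots reading over the strong data, no input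
beyond `hpf₁` / `hpf₂`. [cite: MochizukiEtTh2009, Thm 4.4 p.94] -/
theorem Thm44Hyp.thm44_mkOfConnectedTemperoid_rootsReading_ofGaloisActionConnected'
    (h : Thm44Hyp
      (mkOfConnectedTemperoid X₁ tf₁ hZ₁ hP₁
        (fun _ A M => ∀ (g : A.base ⟶ A₁.base) (x : tf₁.ratFnFunctor.obj (op A₁.base)),
          divB tf₁.divisorMonoid tf₁.ratFnFunctor tf₁.divBNatTrans (op A₁.base) x = 1 →
            ∃ ζ : tf₁.ratFnFunctor.obj (op A.base), ζ ^ (M : ℕ) = pull tf₁.ratFnFunctor g x)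
        A₁ hA₁ hA₁')
      (mkOfConnectedTemperoid X₂ tf₂ hZ₂ hP₂
        (fun _ A M => ∀ (g : A.base ⟶ A₂.base) (x : tf₂.ratFnFunctor.obj (op A₂.base)),
          divB tf₂.divisorMonoid tf₂.ratFnFunctor tf₂.divBNatTrans (op A₂.base) x = 1 →
            ∃ ζ : tf₂.ratFnFunctor.obj (op A.base), ζ ^ (M : ℕ) = pull tf₂.ratFnFunctor g x)
        A₂ hA₂ hA₂')) :
    Thm44_i h ∧
      Thm44_ii h (h.psiModel (isFrobenioid_ofGaloisActionConnected GA₁ hC₁ hpf₁)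
        (isFrobenioid_ofGaloisActionConnected GA₂ hC₂ hpf₂)
        (h.preservesFrobeniusStructure_mkOfConnectedTemperoid_ofGaloisActionConnected GA₁ hC₁ hpf₁ GA₂ hC₂ hpf₂)) ∧
      Thm44_iii h (h.psiModel (isFrobenioid_ofGaloisActionConnected GA₁ hC₁ hpf₁)
        (isFrobenioid_ofGaloisActionConnected GA₂ hC₂ hpf₂)
        (h.preservesFrobeniusStructure_mkOfConnectedTemperoid_ofGaloisActionConnected GA₁ hC₁ hpf₁ GA₂ hC₂ hpf₂)) ∧
      h.PreservesNthRoots (h.psiModel (isFrobenioid_ofGaloisActionConnected GA₁ hC₁ hpf₁)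
        (isFrobenioid_ofGaloisActionConnected GA₂ hC₂ hpf₂)
        (h.preservesFrobeniusStructure_mkOfConnectedTemperoid_ofGaloisActionConnected GA₁ hC₁ hpf₁ GA₂ hC₂ hpf₂))
        (fun φ f => tf₁.pullFracModel φ f) (fun φ f => tf₂.pullFracModel φ f) :=
  h.thm44_mkOfConnectedTemperoid_rootsReading_ofGaloisActionConnected GA₁ hC₁ hpf₁ GA₂ hC₂ hpf₂ _ _ _

end StrongRoots

end BiKummerSetting

end Literature.AnabelianGeometry.EtaleTheta

end
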